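import Summits.CriticalPhenomena.SAWScalingLimit.Theorems.AvoidanceLimit.Negative.AvoidanceLimitWitnessDomains

/-!
# Negative knowledge on crux `AvoidanceLimit`, part 7: the two anchoring clauses cannot both go

Support file (refuter / cdisprove lane, cycle 2) for the crux
`Summit.CriticalPhenomena.SAWScalingLimit.Theses.SAWLoopFugacityFlow.AvoidanceLimit`
(stmt-CriticalPhenomena-10649). The crux ties the subdomain `D'` to the marked points `a, b` of `D`
by TWO clauses: `hpt : D'.pt 0 = D.pt 0 ∧ D'.pt 1 = D.pt 1` and the ε-ball agreement `hball`.
Part 5 (`avoidanceLimitWithoutPt_of`) showed `hpt` is decorative GIVEN `hball`; the work file records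
that dropping `hball` GIVEN `hpt` is a near-miss (false on paper, not cheaply formalisable). Here:
**dropping both is provably fatal** (`avoidanceLimit_false_without_ball_and_pt`): nothing then forces
`D'` to reach `a` or `b`, the pulled-back domain `ℍ ∖ A = φ⁻¹(D')` stays away from `0` and from `∞`,
both normalising filters in `IsRestrictionMap` / `HasRestrictionDeriv` are `⊥`, every Riemann map of
`φ⁻¹(D')` is a "restriction map" with EVERY derivative `d`, and the conclusion would hold with
`d = 1` and `d = 0` at once. Witness: `D = bigSq = (-2,2)²` marked at `±2`, `D' = smallSq = (-1,1)²`.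
Moral for provers: at least one of the two clauses is needed just to make `d` meaningful; together
with parts 2–5 this completes the load-bearing table of the crux's hypotheses. [folklore]
-/

noncomputable section

open Set Filter Topology MeasureTheory Complex Metric
open UpperHalfPlane (upperHalfPlaneSet isOpen_upperHalfPlaneSet)
open Literature.Probability.RandomPlanarGeometry Literature.Probability.LatticeModels
open Summit.CriticalPhenomena.SAWScalingLimit.Theses.SAWLoopFugacityFlow (AvoidanceLimit)

namespace Summit.CriticalPhenomena.SAWScalingLimit.Theorems.AvoidanceLimit.Negative

/-- The small square `(-1, 1)²` (marked anywhere: at the midpoints `1`, `-1` of its vertical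
sides), a Dobrushin subdomain of `bigSq` whose closure misses the marked points `±2` of `bigSq`.
[folklore] -/
def smallSq : DobrushinDomain where
  toJordanDomain := rectDomain 1 1 one_pos one_pos
  mark := ![3 / 8, 7 / 8]
  strictMono_mark := Fin.strictMono_iff_lt_succ.2 fun i ↦ by fin_cases i; simp; norm_num
  mark_mem i := by fin_cases i <;> simp <;> norm_num

/-- The carrier of the small square is the open rectangle `(-1,1)²`. [folklore] -/
theorem smallSq_carrier : smallSq.carrier = symRect 1 1 := rfl

/-- The small square lies in the big square. [folklore] -/
theorem smallSq_subset : smallSq.carrier ⊆ bigSq.carrier := by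
  intro z hz
  rw [smallSq_carrier, mem_symRect] at hz
  rw [bigSq_carrier, mem_symRect]
  exact ⟨⟨by linarith [hz.1.1], by linarith [hz.1.2]⟩, by linarith [hz.2.1], by linarith [hz.2.2]⟩

/-- The marked points `±2` of `bigSq` are off the closed small square. [folklore] -/
theorem bigSq_pt_notMem_closure_smallSq (i : Fin 2) : bigSq.pt i ∉ closure smallSq.carrier := by
  rw [smallSq_carrier, closure_symRect one_pos one_pos, mem_reProdIm]
  fin_cases i
  · simp [bigSq_pt_zero]
  · norm_num [bigSq_pt_one]

/-- The crux with BOTH anchoring clauses DROPPED: no `D'.pt i = D.pt i` and no ε-ball agreement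
(only `D' ⊆ D`), everything else verbatim. -/
def AvoidanceLimitWithoutBallAndPt : Prop :=
  ∀ (D D' : DobrushinDomain) (a b : ℝ → Site 2), SAW.IsEndpointApprox D a b →
    D'.carrier ⊆ D.carrier →
    ∀ (φ : ConformalEquiv upperHalfPlaneSet D.carrier), D.IsChordalUniformizing φ →
    ∀ (A : Set ℂ), A = closure (upperHalfPlaneSet \ {z | z ∈ upperHalfPlaneSet ∧ φ z ∈ D'.carrier}) →
    ∀ (Φ : ConformalEquiv (upperHalfPlaneSet \ A) upperHalfPlaneSet) (d : ℝ),
      IsRestrictionMap A Φ → HasRestrictionDeriv A Φ d →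
      Tendsto (fun δ => ((SAW.law D.carrier δ (a δ) (b δ)).map (fun γ => γ.curve))
        (CurveClass.rangeSubset (closure D'.carrier))) (𝓝[>] 0)
        (𝓝 (ENNReal.ofReal (d ^ ((5 : ℝ) / 8))))

-- Sanity (kept in the crux work file `Cruxes/AvoidanceLimit/Disproof.lean`, not here, since it
-- concludes the Theses decl): `AvoidanceLimitWithoutBallAndPt → AvoidanceLimit` by
-- `fun h D D' a b hab hsub _ _ _ ↦ h D D' a b hab hsub`.

/-- **The marked-point clause and the ball agreement cannot both be dropped.** Witness:
`D = bigSq`, `D' = smallSq = (-1,1)²` (so `closure D' ∌ ±2`), `φ` a chordal uniformizer of `bigSq`: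
`φ z → 2 ∉ closure D'` at `0` and `φ z → -2 ∉ closure D'` at `∞`, so `ℍ ∖ A = φ⁻¹(D')` stays away
from `0` and from `∞`, the filters `𝓝[ℍ ∖ A] 0` and `cocompact ⊓ 𝓟 (ℍ ∖ A)` are `⊥`, any Riemann map
`Φ : ℍ ∖ A → ℍ` is a "restriction map" with EVERY `d`, and the conclusion would give two limits
`1^{5/8} ≠ 0^{5/8}` of one sequence. [folklore] -/
theorem avoidanceLimit_false_without_ball_and_pt : ¬ AvoidanceLimitWithoutBallAndPt := by
  intro h
  obtain ⟨a, b, hab⟩ := SAW.exists_isEndpointApprox bigSq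
  obtain ⟨φ, hφ⟩ := MarkedDomain.exists_isChordalUniformizing_holds bigSq
  set A : Set ℂ := φ.pullbackHull smallSq with hAdef
  have key := h bigSq smallSq a b hab smallSq_subset φ hφ A rfl
  have hdiff : upperHalfPlaneSet \ A = φ.pullbackDomain smallSq := ConformalEquiv.diff_pullbackHull
  -- (1) the filter at `0` is trivial: `φ z → 2 ∉ closure D'`
  have hbot0 : 𝓝[upperHalfPlaneSet \ A] (0 : ℂ) = ⊥ := by
    have hev : ∀ᶠ z in 𝓝[upperHalfPlaneSet] (0 : ℂ), φ z ∈ (closure smallSq.carrier)ᶜ :=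
      hφ.1 (isClosed_closure.isOpen_compl.mem_nhds (bigSq_pt_notMem_closure_smallSq 0))
    have hle : 𝓝[upperHalfPlaneSet \ A] (0 : ℂ) ≤ 𝓝[upperHalfPlaneSet] 0 :=
      nhdsWithin_mono _ sdiff_le
    rw [← Filter.eventually_false_iff_eq_bot]
    filter_upwards [hle hev, self_mem_nhdsWithin] with z hz hzA
    rw [hdiff] at hzA
    exact hz (subset_closure hzA.2)
  -- (2) the filter at `∞` is trivial: `φ z → -2 ∉ closure D'`
  have hbotInf : cocompact ℂ ⊓ 𝓟 (upperHalfPlaneSet \ A) = ⊥ := by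
    have hev : ∀ᶠ z in cocompact ℂ ⊓ 𝓟 upperHalfPlaneSet, φ z ∈ (closure smallSq.carrier)ᶜ :=
      hφ.2 (isClosed_closure.isOpen_compl.mem_nhds (bigSq_pt_notMem_closure_smallSq 1))
    have hle : cocompact ℂ ⊓ 𝓟 (upperHalfPlaneSet \ A) ≤ cocompact ℂ ⊓ 𝓟 upperHalfPlaneSet :=
      inf_le_inf_left _ (principal_mono.2 sdiff_le)
    rw [← Filter.eventually_false_iff_eq_bot]
    have hself : ∀ᶠ z in cocompact ℂ ⊓ 𝓟 (upperHalfPlaneSet \ A), z ∈ upperHalfPlaneSet \ A :=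
      mem_inf_of_right (mem_principal_self _)
    filter_upwards [hle hev, hself] with z hz hzA
    rw [hdiff] at hzA
    exact hz (subset_closure hzA.2)
  -- a Riemann map of `ℍ ∖ A ≅ D'`
  have hsc : IsSimplyConnected (upperHalfPlaneSet \ A) :=
    (φ.restrHull smallSq smallSq_subset).isSimplyConnected_iff.2
      (JordanDomain.isSimplyConnected_carrier smallSq.toJordanDomain)
  have hopen : IsOpen (upperHalfPlaneSet \ A) := by
    rw [hdiff]; exact ConformalEquiv.isOpen_pullbackDomain
  have hne : upperHalfPlaneSet \ A ≠ univ := fun heq ↦ by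
    have : (-I : ℂ) ∈ upperHalfPlaneSet \ A := by rw [heq]; exact mem_univ _
    have h' : (0 : ℝ) < (-I).im := this.1
    norm_num at h'
  obtain ⟨Ψ⟩ := exists_conformalEquiv_upperHalfPlaneSet_holds hopen hsc hne
  set Φ := Ψ.symm with hΦ
  have hR : IsRestrictionMap A Φ := by
    refine ⟨?_, ?_⟩
    · show Tendsto Φ (𝓝[upperHalfPlaneSet \ A] 0) (𝓝 0)
      rw [hbot0]; exact tendsto_bot
    · rw [hbotInf]; exact tendsto_bot
  have hD : ∀ d : ℝ, HasRestrictionDeriv A Φ d := fun d ↦ by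
    show Tendsto _ (𝓝[upperHalfPlaneSet \ A] 0) _
    rw [hbot0]; exact tendsto_bot
  exact one_ne_zero_rpow (limit_unique (key Φ 1 hR (hD 1)) (key Φ 0 hR (hD 0)))

end Summit.CriticalPhenomena.SAWScalingLimit.Theorems.AvoidanceLimit.Negative

end
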